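import Summits.QuantumFields.YangMills.Theorems.LuscherReductionTwistedTraceScalingGaugeActionCovariant
import Summits.QuantumFields.YangMills.Theorems.LuscherReductionTwistedTraceScalingSliceMeets
import HarnessLib

/-!
# The chart coordinates of a tube point: `slowMean (orthoTube u v) = u`, `relLinkVec (orthoTube u v) = linkEmbed v` (capped balanced `v`)
# (lane A of S-BASE, crux `TwistedTraceScaling` stmt-QuantumFields-20203, C4 INNER; design note `pub/ym-fleet/ym-luscher-20007-p1/COARSE-DESIGN.md` §24.4 (G))

The Born–Oppenheimer functions of the assembly are GLOBAL functions `U ↦ φ(slowMean U)·Ω(relLinkVec U)` (no chart inversion); along the orthographic tube they must evaluate to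
`φ(u)·Ω(v)` so that the exact one-site disintegration `integral_configMeasure_orthoTube` applies.  THIS FILE proves the two chart identities (the inverse of `orthoTube` on
its range, complementing `orthoTube_injective` / `mem_orthoTubeSet_of_near_one`):
* `dirQuat_orthoTube_one` — `dirQuat k (orthoTube 1 v) = Σ_x √(1 − |v_{(x,k)}|²)`, a positive real (`sum_chartQuat_eq_coe`); `quatToSU2_coe_pos`;
* ★ `polarMean_orthoTube` / `slowMean_orthoTube` — the polar mean of `orthoTube u v` in direction `k` is `u_k`;
* ★ `relLinkVec_orthoTube` — its relative coordinate is `v` itself; `slow_mul_rel_orthoTube` — hence `φ(slowMean ·)·Ω(relLinkVec ·)` evaluates to `φ(u)Ω(linkEmbed v)` on the tube.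
HONEST FRAMING: chart bookkeeping for a stub of a child of the CONDITIONAL reduction route R2b1; no spectral claim; C4 OPEN; not a gap, not Clay.
-/

set_option autoImplicit false

noncomputable section

open Real
open scoped BigOperators Quaternion
open Literature.MathematicalPhysics.QuantumFieldTheory
open Literature.MathematicalPhysics.QuantumLattice

namespace Summit.QuantumFields.YangMills.Theorems.FemtoTransferGap.TwoLattice.ConstTube

open Summit.QuantumFields.YangMills.Theorems.FemtoTransferGap
open Summit.QuantumFields.YangMills.Theorems.FemtoTransferGap.TwoLattice.Stiff (LinkSpace)

variable (L : ℕ) [NeZero L]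

/-! ## §1 The direction quaternion of `orthoTube 1 v` is a positive real -/

/-- `dirQuat k (orthoTube 1 v) = (Σ_x √(1 − |v_{(x,k)}|²) : ℝ)` for capped balanced `v`. [folklore] -/
theorem dirQuat_orthoTube_one {v : Edge 3 L → Fin 3 → ℝ} (hv : v ∈ capBalancedSet L) (k : Fin 3) :
    dirQuat L k (orthoTube L 1 v) = ((∑ x : Site 3 L, √(1 - ∑ a, v (x, k) a ^ 2) : ℝ) : ℍ) := by
  rw [dirQuat_eq_sum_su2Quat, ← sum_chartQuat_eq_coe L hv k]
  refine Finset.sum_congr rfl fun x _ => ?_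
  rw [orthoTube_apply, Pi.one_apply, mul_one, su2Quat_chartSU2 (sum_sq_le_one_of_cap L hv.2 (x, k))]
  rfl

omit [NeZero L] in
/-- The radial projection of a positive real quaternion is `1`. [folklore] -/
theorem quatToSU2_coe_pos {r : ℝ} (hr : 0 < r) : quatToSU2 (r : ℍ) = 1 := by
  have hr0 : (r : ℍ) ≠ 0 := by
    intro h; exact hr.ne' (Quaternion.coe_injective (by rw [h, Quaternion.coe_zero]))
  apply Subtype.ext
  rw [coe_quatToSU2 hr0, Quaternion.norm_coe, Real.norm_eq_abs, abs_of_pos hr]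
  have : (r⁻¹ : ℝ) • (r : ℍ) = 1 := by
    rw [← Quaternion.coe_smul, smul_eq_mul, inv_mul_cancel₀ hr.ne', Quaternion.coe_one]
  rw [this, quatMatrix_one]
  rfl

/-- The polar mean of `orthoTube 1 v` is `1`. [folklore] -/
theorem polarMean_orthoTube_one {v : Edge 3 L → Fin 3 → ℝ} (hv : v ∈ capBalancedSet L) (k : Fin 3) : polarMean L k (orthoTube L 1 v) = 1 := by
  unfold polarMean
  rw [dirQuat_orthoTube_one L hv k]
  exact quatToSU2_coe_pos (sum_sqrt_pos L hv k)

/-- The direction quaternions of `orthoTube 1 v` are nonzero. [folklore] -/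
theorem dirQuat_orthoTube_one_ne_zero {v : Edge 3 L → Fin 3 → ℝ} (hv : v ∈ capBalancedSet L) (k : Fin 3) : dirQuat L k (orthoTube L 1 v) ≠ 0 := by
  rw [dirQuat_orthoTube_one L hv k]
  intro h
  exact (sum_sqrt_pos L hv k).ne' (Quaternion.coe_injective (by rw [h, Quaternion.coe_zero]))

omit [NeZero L] in
/-- `orthoTube 1 v` is the link-wise chart configuration. [folklore] -/
theorem orthoTube_one_eq (v : Edge 3 L → Fin 3 → ℝ) : (fun e => chartSU2 (v e)) = orthoTube L 1 v := by
  funext e; rw [orthoTube_apply, Pi.one_apply, mul_one]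

/-! ## §2 ★ The slow variable and the relative coordinate of a tube point -/

/-- ★ **`polarMean k (orthoTube u v) = u_k`.** [folklore] -/
theorem polarMean_orthoTube (u : GaugeConfig 3 1 SU2) {v : Edge 3 L → Fin 3 → ℝ} (hv : v ∈ capBalancedSet L) (k : Fin 3) :
    polarMean L k (orthoTube L u v) = u (0, k) := by
  rw [orthoTube_eq_mul_constLift, orthoTube_one_eq, polarMean_mul_constLift L _ u (dirQuat_orthoTube_one_ne_zero L hv k), polarMean_orthoTube_one L hv k, one_mul]

/-- ★ **`slowMean (orthoTube u v) = u`.** [folklore] -/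
theorem slowMean_orthoTube (u : GaugeConfig 3 1 SU2) {v : Edge 3 L → Fin 3 → ℝ} (hv : v ∈ capBalancedSet L) : slowMean L (orthoTube L u v) = u := by
  funext e
  show polarMean L e.2 (orthoTube L u v) = u e
  rw [polarMean_orthoTube L u hv e.2]
  congr 1
  exact Prod.ext (Subsingleton.elim _ _) rfl

/-- ★ **`relLinkVec (orthoTube u v) = linkEmbed v`.** [folklore] -/
theorem relLinkVec_orthoTube (u : GaugeConfig 3 1 SU2) {v : Edge 3 L → Fin 3 → ℝ} (hv : v ∈ capBalancedSet L) : relLinkVec L (orthoTube L u v) = linkEmbed L v := by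
  rw [orthoTube_eq_mul_constLift, orthoTube_one_eq, relLinkVec_mul_constLift L _ u (dirQuat_orthoTube_one_ne_zero L hv)]
  ext ea
  rw [linkEmbed_apply]
  show vecPart (orthoTube L 1 v ea.1 * (polarMean L ea.1.2 (orthoTube L 1 v))⁻¹) ea.2 = v ea.1 ea.2
  rw [polarMean_orthoTube_one L hv, inv_one, mul_one, orthoTube_apply, Pi.one_apply, mul_one, vecPart_chartSU2 (sum_sq_le_one_of_cap L hv.2 ea.1)]

/-- Hence a Born–Oppenheimer function `U ↦ φ(slowMean U)·Ω(relLinkVec U)` evaluates on the tube to `φ(u)·Ω(linkEmbed v)`. [folklore] -/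
theorem slow_mul_rel_orthoTube (φ : GaugeConfig 3 1 SU2 → ℝ) (Ω : LinkSpace L → ℝ) (u : GaugeConfig 3 1 SU2) {v : Edge 3 L → Fin 3 → ℝ} (hv : v ∈ capBalancedSet L) :
    φ (slowMean L (orthoTube L u v)) * Ω (relLinkVec L (orthoTube L u v)) = φ u * Ω (linkEmbed L v) := by
  rw [slowMean_orthoTube L u hv, relLinkVec_orthoTube L u hv]

end Summit.QuantumFields.YangMills.Theorems.FemtoTransferGap.TwoLattice.ConstTube

end
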